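import Mathlib
import HarnessLib
import Summits.KontsevichZagierPeriods.Zeta5Search.TwoTaleWhippleDischarged
import Summits.KontsevichZagierPeriods.Zeta5Search.Denom.TwoTaleL25Forms

/-!
# TwoTaleWhippleL25 — Whipple's transformation at RUNG L(2/5): `q_n = −q̂_n` over the Literature's closed forms

HONEST FRAMING: systematic search; no irrationality claim unless certified.  Cell pub-zeta5 (measure-opt g0), the L(2/5) twin of
P1's `TwoTaleWhippleD1` (file T9 of the D1 programme).  No new input: the tree theorem
`TwoTaleWhipple.whippleRemark5Max_holds` (Whipple's terminating nearly-poised `₄F₃(1)` ↔ Saalschützian `₅F₄(1)`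
transformation [Zudilin2014ZetaTwo, Remark 5], proved by fam-measure) is instantiated at the cone point
`a = (32n+1, 27n+1, 22n+1, 37n+1)`, `b = (1, 5n+1, 10n+1, 64n+2)` (`Denom.TwoTaleL25Forms.aL25/bL25`), whose Remark-5
partner is `â = (79n+2; 27n+1, 32n+1, 37n+1)`, `b̂ = (37n+2; 15n+1, 59n+2, 64n+2)` (`Denom.TwoTaleL25Forms.aTL25/bTL25`):
* `aL25_eq/bL25_eq/aTL25_eq/bTL25_eq` — the L(2/5) data ARE `firstA/firstB/hatA/hatB (32n+1) (27n+1) (22n+1) (37n+1) (64n+2)`;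
* `admissibleTL25` — second-tale admissibility of the partner (`admissibleT_hat`), `rangeL25_eq` (`â₃* = 37n+1`,
  `b̂₂* = 59n+2`);
* **`formQL25_eq_neg_formQTZ`**: `formQL25 n = −formQTZ (aTL25 n) (bTL25 n)` for `n ≥ 1` (`32n+1, 27n+1, 22n+1 ≤ 37n+1`).
The reindexing `formQTZ (aTL25 n) (bTL25 n) = qhatL25 n` (one-signed binomial sum) and `CoeffRateL25 C₁starL25` are in
`TwoTaleL25GrowthLimit`.  Nothing here certifies a measure; no irrationality content.
References: W. Zudilin, arXiv:1310.1526 [Zudilin2014ZetaTwo] §6 and Remark 5; W. N. Bailey, Generalized hypergeometric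
series (1935) §4.5.
-/

noncomputable section

namespace Summit.KontsevichZagierPeriods.Zeta5Search.TwoTaleWhippleL25

open Finset
open Literature.NumberTheory.Irrationality.Zudilin2014
open Summit.KontsevichZagierPeriods.Zeta5Search
open Summit.KontsevichZagierPeriods.Zeta5Search.TwoTaleWhipple
open Summit.KontsevichZagierPeriods.Zeta5Search.Denom.TwoTaleL25Forms

/-! ### The dictionary at L(2/5) -/

/-- L(2/5) first tale `a = (32n+1, 27n+1, 22n+1, 37n+1)` is Remark-5 numerator data. -/
theorem aL25_eq (n : ℕ) : aL25 n = firstA (32 * n + 1) (27 * n + 1) (22 * n + 1) (37 * n + 1) := by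
  ext i; fin_cases i <;> simp

/-- L(2/5) first tale `b = (1, 5n+1, 10n+1, 64n+2)` has the Remark-5 shape `(1, a₄−a₁+1, a₄−a₂+1, b₄)`. -/
theorem bL25_eq (n : ℕ) : bL25 n = firstB (32 * n + 1) (27 * n + 1) (37 * n + 1) (64 * n + 2) := by
  ext i; fin_cases i <;> simp
  all_goals ring

/-- `aTL25` is the Remark-5 `hatA` of the L(2/5) data. -/
theorem aTL25_eq (n : ℕ) : aTL25 n = hatA (32 * n + 1) (27 * n + 1) (22 * n + 1) (37 * n + 1) (64 * n + 2) := by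
  ext i; fin_cases i <;> simp
  all_goals ring

/-- `bTL25` is the Remark-5 `hatB` of the L(2/5) data. -/
theorem bTL25_eq (n : ℕ) : bTL25 n = hatB (32 * n + 1) (27 * n + 1) (22 * n + 1) (37 * n + 1) (64 * n + 2) := by
  ext i; fin_cases i <;> simp
  all_goals ring

/-- The L(2/5) partner is second-tale admissible for `n ≥ 1`. -/
theorem admissibleTL25 {n : ℕ} (hn : 1 ≤ n) : AdmissibleT (aTL25 n) (bTL25 n) := by
  rw [aTL25_eq, bTL25_eq]
  refine admissibleT_hat ?_
  rw [← aL25_eq, ← bL25_eq]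
  exact admissibleL25 hn

/-- `â₃* = 37n+1`, `b̂₂* = 59n+2` at L(2/5). -/
theorem rangeL25_eq (n : ℕ) : aMax3 (aTL25 n) = 37 * (n : ℤ) + 1 ∧ bMin (bTL25 n) = 59 * (n : ℤ) + 2 := by
  constructor
  · unfold aMax3; simp; omega
  · unfold bMin; simp; omega

/-! ### Whipple at L(2/5) -/

/-- **`q_n = −q̂_n` at L(2/5)**: `formQL25 n = −formQTZ (aTL25 n) (bTL25 n)` for `n ≥ 1`, from the tree theorem
`whippleRemark5Max_holds` (`32n+1, 27n+1, 22n+1 ≤ 37n+1`). -/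
theorem formQL25_eq_neg_formQTZ {n : ℕ} (hn : 1 ≤ n) : formQL25 n = -formQTZ (aTL25 n) (bTL25 n) := by
  unfold formQL25
  rw [aL25_eq, bL25_eq, aTL25_eq, bTL25_eq]
  refine whippleRemark5Max_holds _ _ _ _ _ (by omega) (by omega) (by omega) ?_
  rw [← aL25_eq, ← bL25_eq]
  exact admissibleL25 hn

end Summit.KontsevichZagierPeriods.Zeta5Search.TwoTaleWhippleL25

end
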